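/-
Copyright (c) 2026 the pub-hodgecm-mathlib formalisation cell (harness21).  Prover seat hodgecm-mathlib-K2E2-p12 (g5): Track B «K2-LIT», ENGINE E1,
h413 = stmt-HodgeConjecture-24833; R8₂-sph ROAD T′, ruling (110) of K2E1-plan (g6): the SHARED brick T8∕(A1) «HECKE CLOSURE OF `K`-FIXED VECTORS».
-/
import Literature.NumberTheory.Automorphic.HeckeEigenvectorProjection      -- ★ `ClosedSubrep.isTopIrreducible_toContRep_iff` (irreducible ↔ no closed subrep strictly between `⊥` and `Π`)
import HarnessLib

/-!
# K2·E1 — `K2E1HeckeClosureKFixedU` (ruling (110), brick T8∕(A1), shared by roads (A) GELFAND and (C) NO-ADM): FOR AN IRREDUCIBLE CLOSED SUBREPRESENTATION `Π`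
# AND A PROJECTION-LIKE OPERATOR `P` (think `P = P_K`), A NON-ZERO CLOSED SUBSPACE `V ≤ Π` STABLE UNDER ALL `P ∘ π(g)` CONTAINS `P(Π)`; hence a non-zero closed
# `{P_K π(g) P_K}`-stable `V ≤ Π^K` IS ALL OF `Π^K` [Dixmier §13.1; Bump Thm 3.6.1; Garrett p. 331]

Track B ∕ K2-LIT, crux h413 = `stmt-HodgeConjecture-24833`, route of record `HCCMUnconditional`; cell `hodgecm-mathlib`, squad K2, ENGINE E1 (R8₂-sph ROAD T′: T9's `hadm`∕(A3)).
THEOREMS ONLY (no `def`, no instance, no notation, no `sorry`; default heartbeats); lane `--supports stmt-HodgeConjecture-24833 --as helper` (count-neutral).  GENERIC and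
MEASURE-FREE: `π` ANY `ContRepresentation` of a group `G` on a complex Hilbert space, `Π` a topologically irreducible closed subrepresentation, `P : H →L[ℂ] H` ANY bounded
operator (no unitarity, no idempotence needed for the core).  The Hecke operators of a compact (open) `K` on `Π^K` are the `P_K π(g) P_K` (`P_K` = the orthogonal projection onto the
`K`-fixed vectors = `R(e_K)`), and `R(h) = ∫ h(g) P_K π(g) P_K dg` for bi-`K`-invariant `h`; so a closed `{P_K π(g) P_K}`-stable subspace is the operator form of «`𝓗(G∕∕K)`-stable».
PROOF of the core: `Y := closure(span ⋃_g π(g)V)` is a closed invariant subspace of `π` inside `Π`, non-zero, hence `= Π` (irreducibility ★ `isTopIrreducible_toContRep_iff`); `P` is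
continuous and linear, `P(π(g)v) ∈ V` for `v ∈ V`, so `P(Y) ⊆ closure(span P(⋃ π(g)V)) ⊆ V`.
* **`apply_mem_of_isTopIrreducible_of_stable (hΠ) (P) (hVc) (hV0) (hVΠ) (hstab : ∀ g, ∀ v ∈ V, P (π g v) ∈ V) : ∀ w ∈ Π, P w ∈ V`** (core).
* **`inf_eq_of_isTopIrreducible_of_stable`**: if moreover `V ≤ Kfix` and `P` fixes `Kfix` pointwise (`P = P_K`, `Kfix` = the `K`-fixed vectors), then `Π.toSubmodule ⊓ Kfix = V` — «a non-zero
  closed `{P_K π(g) P_K}`-stable `V ≤ Π^K` is `Π^K`» = T8 ∕ (A1) in T9's `Kfix` currency.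
HONEST LABEL: HC_CM is proved only modulo the 7 printed citations (2 remaining named inputs: hLiu418 = `stmt-HodgeConjecture-24832`, h413 = `stmt-HodgeConjecture-24833`) until rung 0
closes; this file asserts no named fact and closes no socket; count-neutral; unconditional.

## References
* [Dixmier1977] J. Dixmier, *C\*-algebras* (1977): §13.1.5 (closed invariant subspaces of a subrepresentation).
* [Bump1997] D. Bump, *Automorphic Forms and Representations* (1997): Thm. 3.6.1 and Prop. 2.2.4 (spherical Hecke algebra acting on `π^K`).
* [Garrett2018] P. Garrett, *Modern Analysis of Automorphic Forms by Example* (2018): p. 331 («the closure of `A·w`»).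
-/

set_option autoImplicit false
set_option linter.dupNamespace false -- the mandated namespace repeats `HodgeConjecture.HodgeConjecture`

noncomputable section

open ContRepresentation ContRepresentation.ClosedSubrep

namespace Summit.HodgeConjecture.HodgeConjecture.Cruxes.H413.K2E1HeckeClosureKFixedU

variable {G H : Type*} [Group G] [NormedAddCommGroup H] [InnerProductSpace ℂ H] {π : ContRepresentation ℂ G H}

/-- **THE CORE (T8∕(A1))**: for `Π` a topologically irreducible closed subrepresentation of `π`, `P : H →L[ℂ] H` any bounded operator, and `V` a non-zero closed subspace of `Π` such that
`P (π g v) ∈ V` for all `g ∈ G`, `v ∈ V`: `P w ∈ V` for EVERY `w ∈ Π` (the closed span of the orbit of `V` is a non-zero closed invariant subspace of `Π`, hence `Π`; apply the continuous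
linear `P`). [cite: Dixmier1977, §13.1.5] [cite: Bump1997, Thm. 3.6.1] [cite: Garrett2018, p. 331] -/
theorem apply_mem_of_isTopIrreducible_of_stable {Q : ClosedSubrep π} (hQ : Q.toContRep.IsTopIrreducible) (P : H →L[ℂ] H)
    {V : Submodule ℂ H} (hVc : IsClosed (V : Set H)) (hV0 : V ≠ ⊥) (hVQ : V ≤ Q.toSubmodule)
    (hstab : ∀ g : G, ∀ v ∈ V, P (π g v) ∈ V) : ∀ w ∈ Q, P w ∈ V := by
  -- the orbit of `V` and the closed span `Y`
  set O : Set H := {x | ∃ g : G, ∃ v ∈ V, x = π g v} with hO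
  set S : Submodule ℂ H := Submodule.span ℂ O with hS
  have hOinv : ∀ g : G, Set.MapsTo (π g) O O := by
    rintro g x ⟨g', v, hv, rfl⟩
    refine ⟨g * g', v, hv, ?_⟩
    rw [map_mul]
    rfl
  have hSinv : ∀ g : G, Set.MapsTo (π g) (S : Set H) (S : Set H) := fun g x hx => by
    have h : S.map (π g : H →ₗ[ℂ] H) ≤ S := by
      rw [hS, Submodule.map_span]
      exact Submodule.span_mono (Set.image_subset_iff.2 fun x hx => hOinv g hx)
    exact h (Submodule.mem_map_of_mem hx)
  let Y : ClosedSubrep π :=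
    { toSubmodule := S.topologicalClosure
      apply_mem_toSubmodule := fun g v hv => by
        have hcl := (hSinv g).closure (π g).continuous
        rw [← Submodule.topologicalClosure_coe] at hcl
        exact hcl hv
      isClosed' := Submodule.isClosed_topologicalClosure _ }
  -- `Y ≤ Q`, `Y ≠ ⊥`, hence `Y = Q`
  have hOQ : O ⊆ (Q : Set H) := by
    rintro x ⟨g, v, hv, rfl⟩
    exact Q.apply_mem g (hVQ hv)
  have hSQ : S ≤ Q.toSubmodule := Submodule.span_le.2 hOQ
  have hYQ : Y ≤ Q := fun v hv => (S.topologicalClosure_minimal hSQ Q.isClosed) hv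
  have hVS : V ≤ S := fun v hv => Submodule.subset_span ⟨1, v, hv, by rw [map_one]; rfl⟩
  have hY0 : Y ≠ ⊥ := by
    intro h0
    apply hV0
    rw [eq_bot_iff]
    intro v hv
    have h : v ∈ Y := S.le_topologicalClosure (hVS hv)
    rw [h0, ClosedSubrep.mem_bot] at h
    rw [h]
    exact (⊥ : Submodule ℂ H).zero_mem
  have hYeq : Y = Q := (((isTopIrreducible_toContRep_iff Q).1 hQ).2 Y hYQ).resolve_left hY0
  -- `P(S) ≤ V`, hence `P(Y) ≤ V`
  have hPS : S.map (P : H →ₗ[ℂ] H) ≤ V := by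
    rw [hS, Submodule.map_span]
    refine Submodule.span_le.2 ?_
    rintro x ⟨y, ⟨g, v, hv, rfl⟩, rfl⟩
    exact hstab g v hv
  intro w hw
  have hwY : w ∈ Y := by rw [hYeq]; exact hw
  have hmaps : Set.MapsTo P (S : Set H) (V : Set H) := fun x hx => hPS (Submodule.mem_map_of_mem hx)
  have hcl := hmaps.closure P.continuous
  rw [hVc.closure_eq, ← Submodule.topologicalClosure_coe] at hcl
  exact hcl hwY

/-- **T8∕(A1) IN T9's CURRENCY**: with `Kfix` a submodule fixed pointwise by `P` (e.g. `Kfix` = the `K`-fixed vectors, `P = P_K` the orthogonal projection onto them) and `V ≤ Π ⊓ Kfix` a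
non-zero closed `{P ∘ π(g)}`-stable subspace (= stable under the Hecke operators `P_K π(g) P_K` of `Π^K`): `Π.toSubmodule ⊓ Kfix = V` — «`Π^K` is an irreducible module for the
(spherical) Hecke operators». [cite: Bump1997, Thm. 3.6.1] [cite: Garrett2018, p. 331] -/
theorem inf_eq_of_isTopIrreducible_of_stable {Q : ClosedSubrep π} (hQ : Q.toContRep.IsTopIrreducible) (P : H →L[ℂ] H)
    (Kfix : Submodule ℂ H) (hPfix : ∀ w ∈ Kfix, P w = w)
    {V : Submodule ℂ H} (hVc : IsClosed (V : Set H)) (hV0 : V ≠ ⊥) (hVQ : V ≤ Q.toSubmodule) (hVK : V ≤ Kfix)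
    (hstab : ∀ g : G, ∀ v ∈ V, P (π g v) ∈ V) : Q.toSubmodule ⊓ Kfix = V := by
  refine le_antisymm (fun w hw => ?_) (le_inf hVQ hVK)
  have h := apply_mem_of_isTopIrreducible_of_stable hQ P hVc hV0 hVQ hstab w hw.1
  rwa [hPfix w hw.2] at h

end Summit.HodgeConjecture.HodgeConjecture.Cruxes.H413.K2E1HeckeClosureKFixedU

end
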